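import Literature.MathematicalPhysics.QuantumFieldTheory.Balaban1983to89.B1Ineq234BackgroundTorus

/-!
# `Balaban1983to89.B1Props21to23RegularTorus` — T. Bałaban, *(Higgs)₂,₃ quantum fields in a finite volume. I. A lower bound*,
# Commun. Math. Phys. **85** (1982) 603–626 [Balaban1982Higgs1], PROPOSITIONS 2.1–2.3 pp. 610–612 ON `Ω = T_ε` **AT A GENERAL
# REGULAR FIELD `A`** — (2.25) value clause with its decay factor, (2.27), (2.33) lower half, (2.34), (2.36) — *"independent of
# A, k, Ω and Λ"*, *"for e sufficiently small"* ([B4] p. 593): the r14 g13 / p35 g9 background files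
# (`B1Ineq225DecayBackgroundTorus`, `B1Ineq227BackgroundTorus`, `B1Ineq233LowerBackgroundTorus`, `B1Ineq234BackgroundTorus`), which are
# stated at the particular background `A^{(k),ε}` of (3.29), re-assembled for EVERY `δ`-regular `A : T_ε → ℝ^d` with ONE smallness
# parameter `L^kδ·|e|` (for the printed regularity (2.23) `L^kδ = ce(L^kε)^β`, `β ≧ 0`, this is `ce²`: «e sufficiently small»).

statement-level skeleton of published theorems with citation tags; proofs where landed; nothing here is a claim about the Yang–Mills mass gap

PDF held: `paper:balaban1982-cmp85-higgs23-i` (journal page = PDF page + 602): p. 610 [PDF 8] (Prop. 2.1 (2.23)–(2.25), Prop. 2.2),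
p. 611 [PDF 9] ((2.27), Prop. 2.3 (2.33)–(2.34)), p. 612 [PDF 10] ((2.36)); `paper:balaban1983-cmp89-regularity-decay` (journal = PDF + 570):
p. 573 [PDF 3] (Theorem, (1.9)–(1.10)), p. 574 ((1.21)–(1.22)), pp. 577–579 ((2.12)–(2.22)), p. 580 (Cor. 2.3), pp. 593–594 (§5).

CITATION HEADER (lean-in-tree rule).  Cell `lit-balaban` (HOME `run/shared/lean/pub/lit-balaban/`), reader/typer seat **r14** gen 13
(unit `lit-balaban-r14`, B1 fold owner; TAKING line HOME/STATUS.md 2026-08-22T03:19:04Z, free-target protocol G.5-34(d)), SKELETON rows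
**B1.Prop2.1** ((2.25) value clause + decay; owner of the torus decay programme p35 — this file is an XREF re-assembly of p35 g8–g9's
`B1TorusCubeBoxOp.cube_inputs` (GENERAL `A`, chart regularity) and `B1Ineq225DecayBackgroundTorus.norm_propagatorK_univ_decay_le`
(ANY `A`, modulo cube inputs), whose only background-specific step — reading the lattice regularity of `A^{(K),ε}` in the cube chart —
is redone here for a general regular `A`), **B1.Prop2.2** ((2.27)), **B1.Prop2.3** ((2.33)ₗ, (2.34), (2.36)); referee ref-1.  USED BY NAME,
never restated: p35's `B1TorusCubeBoxOp.{acT, cube_inputs}`, `B1TorusCubeChart.{dd, castD, toT, toT_add_e1, predL_succ, M2}`,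
`B1TorusCubeCover.{half, Lab, cube, hTor}`, `B1TorusCubeLocality26.{rS, cubeVec}`, `B1Ineq225DecayBackgroundTorus.{norm_propagatorK_univ_decay_le,
eight_rS_le}`, `B1Ineq225BackgroundTorus.three_half_le_sites`, `B4Lemma22ReduceZero.Box`, `B4Lower18Regular.e1`; r14 g13's
`B1Ineq227BackgroundTorus.{ineq227_of_decay, decay_mono_rate}` (p316504), `B1Ineq233LowerBackgroundTorus.ineq233_lower_regular_torus`
(p317716), `B1Ineq234BackgroundTorus.{two_le_sitesPerDir, mesh_inv_sq_facts}` (p318167); r14 g7/g9 `B1Ineq234Concrete.{ineq234_concrete_of_deltaKA,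
ineq236_concrete_of_deltaKA, profile, nCol, distC}`, `B1Ineq234ZeroFieldRegionUniform.{decay_transfer, profile_anti}`, `B4Sect5Torus.{cSt, dSt}`;
p23's `B2Ineq329RegularField.gamma0_regular_spec`; the typer's `HiggsCovariance.{propagatorK, covOpK}`, `HiggsCondCov232.{condCov232,
deltaCov235}`, p35's `B1Eq230FluctCov.{deltaKA, precOpA, mat}`.

WHAT IS PRINTED (verbatim, [B1] pp. 610–612 [PDF 8–10] = OCR `p0008.txt`–`p0010.txt`; the print states Props. 2.1–2.3 for the operators
RESCALED TO THE UNIT LATTICE `η = L^{−k}` ((2.22), (2.31)); our `L^kε`-lattice reading follows the quotations and is NOT part of them —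
v1.1 docfix, ref-4 S-B1-g40-1 / ref-1 F4).  p. 610: *"Proposition 2.1. Let a set Ω satisfies Ω = B^k(Ω^{(k)}) and let Ω^{(k)} ⊂ T^{(k)}_1
be a sum of big blocks with M sufficiently large. Further, let a configuration A be regular on Ω in the sense that |(∂^η_μA_ν)(x)| ≦
c(e(L^kε))^{β−1}, x ∈ Ω, μ = 1, …, d, (2.23) where e(L^kε) = e(L^kε)^{(4−d)/2}, η = L^{−k}, β > 0 and c is some universal constant. …
Then for e(L^kε) sufficiently small and α < 1 there exist positive constants δ₀, c₀, R₀ independent of A, k, Ω and depending on d, α,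
M only, c₀ on α also, such that for an arbitrary function f : Ω → R^N we have"* [(2.24), the Hölder quotient] *"for x, x′ ∈ Ω and
satisfying the condition dist({x, x′}, Ωᶜ) ≧ R₀. Similarly we have |(D^η_{A,μ}G_k(Ω, A)f)(x)|, |(G_k(Ω, A)f)(x)| ≦ c₀exp(−δ₀dist(x,
supp f))‖f‖_∞ (2.25) for x ∈ Ω, dist(x, Ωᶜ) ≧ R₀."*; p. 611: *"Proposition 2.2. If a configuration A is regular in the same sense as in
Proposition 2.1 then there exist constants δ₀ > 0 and c₀, depending on the same quantities as in Proposition 2.1, such that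
|Δ^{(k)}(Ω, A; x, x′)| ≦ c₀exp(−δ₀|x − x′|), x, x′ ∈ Ω^{(k)}_1 (2.27)"*; *"Here we will assume that the set Λ is a union of big blocks of
T^{(k)}_1. Proposition 2.3. If a configuration A is regular on Ω in the sense defined in Proposition 2.1, then there exist positive
constants δ₀, c₀, γ₀, γ₁ dependent on d and a, and independent of A, k, Ω and Λ, such that"* [display (2.33), illegible in the OCR, read
on the page render by ref-1: `γ₀I ≦ aL^{−2}P(A) + Δ^{(k)}(Ω, A) ≦ γ₁I`] [display (2.34): `|C^{(k)}_Λ(Ω, A; x, x′)| ≦ c₀exp(−δ₀|x − x′|)`]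
*"x, x′ ∈ Λ. (2.34)"*; p. 612: *"|δC^{(k)}_Λ(Ω, A; x, x′)| ≦ c₀exp(−δ₀(|x − x′| + dist(x, Λᶜ) + dist(x′, Λᶜ))), x, x′ ∈ Λ. (2.36)"*.
[B4] p. 593: *"for e sufficiently small and we get the lower bound"*.
READING (ours, lattice units — NOT a quotation).  On the `L^kε`-lattice of this file (2.25) becomes the sup bound
`‖(G^ε_k(T_ε, A)f)(x)‖ ≦ c₀(L^kε)²e^{−δ₀(L^kε)^{−1}dist(x, supp f)}sup‖f‖` (the factor `(L^kε)²` from (2.22)), (2.27) carries the factor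
`(L^kε)^{−2}` ((2.22): `Δ^{(k)}` vs `Δ^{(k),L^kε}`) and (2.34)/(2.36) the factor `(L^kε)²` ((2.30) vs (2.31)); the print's constants depend on
`d, α, M` (Prop. 2.1/2.2) resp. `d, a` (Prop. 2.3) — ours are weaker, HONEST SCOPE (ii).

DICTIONARY.  As in the four background files (torus `Ω = T_ε` of the (Higgs)₂,₃ model `HiggsLattice.Params`, sub-family `Shape`; cubes of
p35's cover `cube K K₀ j`, cube size `K₀` = the print's `M`; `(2.25)` ↦ the sup bound on `propagatorK C univ A m² a K g x` with the factor
`e^{−δ₀D/L^K}` for sources vanishing within (1.3)-distance `D`; `Δ^{(k)}`, `C^{(k)}_Λ`, `δC` ↦ `deltaKA`, `condCov232`, `deltaCov235` in the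
`(L^kε)`-lattice normalization).  «A regular», (2.23) ↦ `|A(z + εe_ν, μ) − A(z, μ)| ≦ δ` on `T_ε` (lattice units) with the smallness
`L^{2k}ε|e|δ ≦ c_e(K₀)` (§1–§3) resp. `L^kδ·|e| ≦ t` (§4–§5); for (2.23) `δ = ε·ce(L^kε)^{β−1}`: `L^kδ|e| = ce²(L^kε)^β ≦ ce²`.

WHAT THIS FILE PROVES (kernel-checked, zero `sorry`, standard axioms; theorems only — no definition, no `Prop`-valued fact).
* §1 **`cube_inputs_regular`** — the cube inputs (2.17)/(2.20) of [B4] Theorem (1.10) for every `δ`-regular `A` with `L^{2K}ε|e|δ ≦ c_e(K₀)`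
  (p35's `cube_inputs` at charge `e₁`, pair `(1, ½)`; the chart regularity is the lattice regularity through `toT_add_e1`).
* §2 **`norm_propagatorK_regular_decay_of_cubes`**, `norm_propagatorK_regular_decay` — (2.25) VALUE CLAUSE WITH DECAY on `T_ε` at a general
  regular `A`: `‖(G^ε_K(T_ε, A)g)(x)‖ ≦ c₀(L^Kε)²e^{−δ₀(K₀)D/L^K}‖g‖_∞` for `g` vanishing within distance `D` of `x`.
* §3 **`ineq227_regular_torus`** — (2.27) on `T_ε` at a general regular `A`: `|Δ^{(k),L^kε}(T_ε, A)(p, q)| ≦ c(L^kε)^{−2}e^{−δ₀(K₀)|x_p − x_q|}`.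
* §4 **`ineq233_lower_regular_torus_small`** — (2.33) LOWER HALF on `T_ε` at a general regular `A` with ONE smallness parameter: `∃ t₀, γ > 0`
  (functions of `d, L, a, m²`): `L^kδ|e| ≦ t₀ ⇒ γ(L^kε)^{−2}‖ψ‖² ≦ ⟨ψ, (a(L^{k+1}ε)^{−2}P(A) + Δ^{(k),L^kε}(T_ε, A))ψ⟩`.
* §5 **`ineq234_236_regular_torus`**, `_std` — (2.34) AND (2.36) on `T_ε` at a general regular `A`, every `1 ≦ k < K_P`, every `Λ ⊂ T^{(k)}`,
  constants `c₁(K₀), δ₁(K₀)` uniform in `k`, `ε`, the volume, `Λ` AND `A`: for `L^kδ|e| ≦ t_A(K₀)`,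
  `|C^{(k),L^kε}_Λ(T_ε, A)(p,q)| ≦ (L^kε)²c₁e^{−δ₁|x_p−x_q|}`, `|δC^{(k),L^kε}_Λ(T_ε, A)(p,q)| ≦ (L^kε)²c₁e^{−δ₁(|x_p−x_q| + dist(x_p,Λᶜ) + dist(x_q,Λᶜ))}`.
HONEST SCOPE.  (i) `Ω = T_ε` only (regions need (2.25) at `A ≠ 0` for regions, not in the tree).  (ii) (2.25): the VALUE clause with its
decay factor; the Hölder clause (2.24) at a regular `A` is p35's programme (`B1TorusCubeHolderInput`), not here.  (iii) The charge `(e, q)` is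
FIXED in each statement (the thresholds `c_e(K₀)`, `t_A(K₀)` depend on it through p35's contour system); the print's «e sufficiently small»
is rendered as the smallness of `L^kδ·|e|` resp. `L^{2k}ε|e|δ` — for (2.23) with `β ≧ 0` these are `≦ ce²`.  (iv) Constants: `K₀` (= print's
`M`) large, rates `δ₀(K₀) = min{4log2/(5K₀+8), 1}`, `(c₁, δ₁)` through r14 g7/g9's `cSt`/`dSt`; (2.33)ₗ constant `min{a, 4γ₀}/(2L²)`.  (v) Value =
the printed quantifier structure «independent of A» for Props. 2.2–2.3 on the torus of the concrete carrier; NOT summit progress.  Unit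
`lit-balaban-r14-g13` (literature-prover-lit-balaban-r14-g13-0); HOME/FILED.md records the proposal.
-/

noncomputable section

open scoped BigOperators InnerProductSpace

namespace Literature.MathematicalPhysics.QuantumFieldTheory.Balaban1983to89.B1Props21to23RegularTorus

open Literature.MathematicalPhysics.QuantumFieldTheory.Balaban1983to89.HiggsLattice (ChargeData sderiv)
open Literature.MathematicalPhysics.QuantumFieldTheory.Balaban1983to89.HiggsCovariance (propagatorK covOpK)
open Literature.MathematicalPhysics.QuantumFieldTheory.Balaban1983to89.HiggsCovariancePos (isUnit_covOpK covOpK_mul_propagatorK)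
open Literature.MathematicalPhysics.QuantumFieldTheory.Balaban1983to89.B1Eq211ZeroFieldTorus (Shape)
open Literature.MathematicalPhysics.QuantumFieldTheory.Balaban1983to89.B1TorusCubeCover (half Lab Near cube hTor)
open Literature.MathematicalPhysics.QuantumFieldTheory.Balaban1983to89.B1TorusCubeLocality26 (rS cubeVec)
open Literature.MathematicalPhysics.QuantumFieldTheory.Balaban1983to89.B1TorusCubeChart (dd castD toT toT_add_e1)
open Literature.MathematicalPhysics.QuantumFieldTheory.Balaban1983to89.B1TorusCubeBoxOp (acT cube_inputs)
open Literature.MathematicalPhysics.QuantumFieldTheory.Balaban1983to89.B4Lemma22ReduceZero (Box)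
open Literature.MathematicalPhysics.QuantumFieldTheory.Balaban1983to89.B4Lower18Regular (e1)
open Literature.MathematicalPhysics.QuantumFieldTheory.Balaban1983to89.B1Ineq225BackgroundTorus (three_half_le_sites)
open Literature.MathematicalPhysics.QuantumFieldTheory.Balaban1983to89.B1Ineq225DecayBackgroundTorus (norm_propagatorK_univ_decay_le eight_rS_le)

variable {P : HiggsLattice.Params} {N : ℕ}

/-! ## §1 The cube inputs (2.17)/(2.20) at a general regular field -/

section CubeInputs

/-- **THE CUBE INPUTS OF THEOREM (1.10) AT A GENERAL REGULAR FIELD.**  For the sub-family of tori (`P.d = d`, `P.L = L`), `a, m² > 0`, a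
charge `(e, q)` and `ε₀`: constants `C_γ, C_β > 0` and, for every cube size `K₀`, a threshold `c_e(K₀) > 0` such that for `K₀ ≧ 8`, on
every torus with `K₀ ∣ M`, at every level `1 ≦ K ≦ K_P` with `3·L^KK₀ ≦ |T_ε|_μ`, `L^Kε ≦ ε₀`, for every `A : T_ε → ℝ^d` which is
`δ`-REGULAR, `|A(z + εe_ν, μ) − A(z, μ)| ≦ δ` on `T_ε`, with `L^{2K}·ε·|e|·δ ≦ c_e(K₀)` (i.e. `(L^Kδ)(L^Kε)|e| ≦ c_e`: for the printed
(2.23) `L^Kδ = ce(L^Kε)^β` this is «e sufficiently small»), every cube satisfies `‖G_j(h_jψ)‖_∞ ≦ C_γ(L^Kε)²‖ψ‖_∞` ((2.17)) and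
`‖K_jG_j(h_jψ)‖_∞ ≦ (C_β/K₀)‖ψ‖_∞` ((2.20)) at `Ã_j = cubeVec A` — p35's `B1TorusCubeBoxOp.cube_inputs` (charge `e₁`, pair `(1, ½)`), whose
chart-regularity hypothesis is the lattice regularity read in the cube chart (`toT_add_e1`); p35 g9's `cube_inputs_bgVec` is the case
`A = A^{(K),ε}`. [cite: Balaban1982Higgs1, Prop. 2.1 (2.23)–(2.25) p.610] [cite: Balaban1983RegularityDecay, Lemma 2.2 (2.17) p.578, (2.20) p.578, (1.21) p.574] -/
theorem cube_inputs_regular (d L : ℕ) (hL : Odd L ∧ 1 < L) {a : ℝ} (ha : 0 < a) {msq : ℝ} (hmsq : 0 < msq) (N : ℕ)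
    (C : ChargeData N) (ε₀ : ℝ) :
    ∃ Cγ Cβ : ℝ, 0 < Cγ ∧ 0 < Cβ ∧ ∃ ce : ℕ → ℝ, (∀ K₀, 0 < ce K₀) ∧ ∀ K₀ : ℕ, 8 ≤ K₀ →
      ∀ (P : HiggsLattice.Params) (_S : Shape P), P.d = d → P.L = L → K₀ ∣ P.M →
      ∀ {K : ℕ}, 1 ≤ K → K ≤ P.K → (∀ μ, 3 * half P K K₀ ≤ P.sitesPerDir 0 μ) → P.mesh K ≤ ε₀ →
      ∀ (A : HiggsLattice.VecField P 0) {δ : ℝ},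
        (∀ (z : HiggsLattice.Site P 0) (μ ν : Fin P.d), |A ⟨z.shift ν, μ⟩ - A ⟨z, μ⟩| ≤ δ) →
        ((P.L : ℝ) ^ K) ^ 2 * P.mesh 0 * |C.e| * δ ≤ ce K₀ → ∀ j : Lab P K K₀,
        (∀ ψ : HiggsLattice.ScalarField P 0 N,
            ‖propagatorK C (cube K K₀ j) (cubeVec K K₀ j A) msq a K (hTor K K₀ j • ψ)‖ ≤ Cγ * P.mesh K ^ 2 * ‖ψ‖) ∧
        (∀ ψ : HiggsLattice.ScalarField P 0 N,
            ‖covOpK C (cube K K₀ j) (cubeVec K K₀ j A) msq a K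
                (hTor K K₀ j • propagatorK C (cube K K₀ j) (cubeVec K K₀ j A) msq a K (hTor K K₀ j • ψ))
              - hTor K K₀ j • covOpK C (cube K K₀ j) (cubeVec K K₀ j A) msq a K
                (propagatorK C (cube K K₀ j) (cubeVec K K₀ j A) msq a K (hTor K K₀ j • ψ))‖
              ≤ Cβ / K₀ * ‖ψ‖) := by
  have hℓ0 : 1 ≤ L - 1 := by have := hL.2; omega
  obtain ⟨Cγ, Cβ, hCγ, hCβ, hci⟩ := cube_inputs C (d - 1) (L - 1) hℓ0 a a (msq * ε₀ ^ 2) ha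
  have hci' : ∀ K₀ : ℕ, ∃ e₁ : ℝ, 0 < e₁ ∧ _ := fun K₀ => hci 1 (1 / 2) zero_le_one (by norm_num) (max K₀ 8) (le_max_right _ _)
  choose e₁ he₁ hthr' using hci'
  refine ⟨Cγ, Cβ, hCγ, hCβ, fun K₀ => Real.sqrt (e₁ K₀), fun K₀ => Real.sqrt_pos.2 (he₁ K₀), fun K₀ hK₀8 => ?_⟩
  have hmax : max K₀ 8 = K₀ := max_eq_left hK₀8
  have hthr := hthr' K₀
  rw [hmax] at hthr
  intro P S hPd hPL hK₀M K hK1 hK hN3 hε A δ hreg hce j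
  subst hPd
  have he₁K := he₁ K₀
  have hdd : dd P = P.d - 1 := rfl
  have hPL1 : P.L - 1 = L - 1 := by rw [hPL]
  have hmesh : 0 < P.mesh K := P.mesh_pos K
  have hmesh0 : 0 < P.mesh 0 := P.mesh_pos 0
  have hcap : msq * P.mesh K ^ 2 ≤ msq * ε₀ ^ 2 :=
    mul_le_mul_of_nonneg_left (pow_le_pow_left₀ hmesh.le hε 2) hmsq.le
  have hδ0 : 0 ≤ δ := (abs_nonneg _).trans (hreg (default : HiggsLattice.Site P 0) ⟨0, P.hd⟩ ⟨0, P.hd⟩)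
  have hnR : ((((P.L - 1 + 1) ^ K : ℕ)) : ℝ) = (P.L : ℝ) ^ K := by
    rw [B1TorusCubeChart.predL_succ, Nat.cast_pow]
  have hLpos : (0 : ℝ) < (P.L : ℝ) := by exact_mod_cast P.hL
  have hpow : (0 : ℝ) < (P.L : ℝ) ^ K := pow_pos hLpos K
  -- the lattice regularity read in the cube chart, at charge `e_c = e₁`, pair `(1, ½)`
  have h17 : ∀ y ∈ Box (dd P) (P.L - 1) K (B1TorusCubeChart.M2 P K₀), ∀ i i' : Fin (dd P + 1),
      |acT K K₀ j ((((P.L - 1 + 1) ^ K : ℕ) : ℝ) * P.mesh 0 * C.e / e₁ K₀) A (y + e1 i) i'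
        - acT K K₀ j ((((P.L - 1 + 1) ^ K : ℕ) : ℝ) * P.mesh 0 * C.e / e₁ K₀) A y i'|
        ≤ 1 * e₁ K₀ ^ ((1 : ℝ) / 2 - 1) / ((P.L - 1 + 1) ^ K : ℕ) := by
    intro y _ i i'
    unfold acT
    rw [toT_add_e1, ← mul_sub, abs_mul, hnR]
    have hσ : |(P.L : ℝ) ^ K * P.mesh 0 * C.e / e₁ K₀| = (P.L : ℝ) ^ K * P.mesh 0 * |C.e| / e₁ K₀ := by
      rw [abs_div, abs_mul, abs_mul, abs_of_pos hpow, abs_of_pos hmesh0, abs_of_pos he₁K]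
    rw [hσ]
    have hexp : e₁ K₀ ^ ((1 : ℝ) / 2 - 1) = (Real.sqrt (e₁ K₀))⁻¹ := by
      rw [show (1 : ℝ) / 2 - 1 = -(1 / 2) by norm_num, Real.rpow_neg he₁K.le, Real.sqrt_eq_rpow]
    rw [hexp, one_mul]
    have hd := hreg (toT K K₀ j y) (castD P i') (castD P i)
    calc (P.L : ℝ) ^ K * P.mesh 0 * |C.e| / e₁ K₀ * |A ⟨(toT K K₀ j y).shift (castD P i), castD P i'⟩ - A ⟨toT K K₀ j y, castD P i'⟩|
        ≤ (P.L : ℝ) ^ K * P.mesh 0 * |C.e| / e₁ K₀ * δ := mul_le_mul_of_nonneg_left hd (by positivity)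
      _ = (((P.L : ℝ) ^ K) ^ 2 * P.mesh 0 * |C.e| * δ) / (e₁ K₀ * (P.L : ℝ) ^ K) := by
          field_simp
      _ ≤ Real.sqrt (e₁ K₀) / (e₁ K₀ * (P.L : ℝ) ^ K) := div_le_div_of_nonneg_right hce (by positivity)
      _ = (Real.sqrt (e₁ K₀))⁻¹ / ((P.L : ℝ) ^ K) := by
          rw [← Real.sqrt_div_self, div_div]
  exact hthr P hdd hPL1 K hK1 hK hK₀M hN3 a msq le_rfl le_rfl hmsq hcap j A (e₁ K₀) he₁K le_rfl h17

end CubeInputs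

/-! ## §2 (2.25), value clause with its decay factor, on `T_ε` at a general regular field -/

section Main

/-- **PROP. 2.1 (2.25), VALUE CLAUSE WITH ITS DECAY FACTOR, ON `Ω = T_ε` AT A GENERAL REGULAR `A` — B4's THEOREM (1.10) VALUE MEMBER
WITH `exp(−δ₀dist)`.**  For `odd L > 1`, `a, m² > 0`, `N`, `(e, q)`, `ε₀`: constants `c₀ > 0`, `K₀min`, and per cube size `K₀` a threshold
`c_e(K₀) > 0` and a rate `δ₀(K₀) > 0`, such that for `K₀ ≧ K₀min`, on every torus of the sub-family with `K₀ ∣ M`, at every level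
`1 ≦ K ≦ K_P` with `3·L^KK₀ ≦ |T_ε|_μ`, `L^Kε ≦ ε₀`, for every `δ`-regular `A` on `T_ε` with `L^{2K}ε|e|δ ≦ c_e(K₀)`, every `g` with
`‖g‖_∞ ≦ M′` vanishing at the sites within (1.3)-distance `< D` of `x`: `‖(G^ε_K(T_ε, A)g)(x)‖ ≦ c₀(L^Kε)²·exp(−δ₀(K₀)·D/L^K)·M′` — p35's
`norm_propagatorK_univ_decay_le` on §1's cube inputs, verbatim the assembly of `norm_propagatorK_bgVec_decay_of_cubes`.
[cite: Balaban1982Higgs1, Prop. 2.1 (2.25) p.610] [cite: Balaban1983RegularityDecay, Theorem (1.10) p.573; (2.22) p.579] -/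
theorem norm_propagatorK_regular_decay_of_cubes (d L : ℕ) (hL : Odd L ∧ 1 < L) {a : ℝ} (ha : 0 < a) {msq : ℝ} (hmsq : 0 < msq)
    (N : ℕ) (C : ChargeData N) (ε₀ : ℝ) :
    ∃ c₀ : ℝ, 0 < c₀ ∧ ∃ K₀min : ℕ, ∃ ce δA : ℕ → ℝ, (∀ K₀, 0 < ce K₀ ∧ 0 < δA K₀) ∧ ∀ K₀ : ℕ, K₀min ≤ K₀ →
      ∀ (P : HiggsLattice.Params) (_S : Shape P), P.d = d → P.L = L → K₀ ∣ P.M →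
      ∀ {K : ℕ}, 1 ≤ K → K ≤ P.K → (∀ μ, 3 * half P K K₀ ≤ P.sitesPerDir 0 μ) → P.mesh K ≤ ε₀ →
      ∀ (A : HiggsLattice.VecField P 0) {δ : ℝ},
        (∀ (z : HiggsLattice.Site P 0) (μ ν : Fin P.d), |A ⟨z.shift ν, μ⟩ - A ⟨z, μ⟩| ≤ δ) →
        ((P.L : ℝ) ^ K) ^ 2 * P.mesh 0 * |C.e| * δ ≤ ce K₀ →
        ∀ (g : HiggsLattice.ScalarField P 0 N) (M D : ℝ), (∀ x, ‖g x‖ ≤ M) → 0 ≤ D →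
          ∀ x, (∀ z, g z ≠ 0 → D ≤ (HiggsLattice.Site.tdist x z : ℝ)) →
            ‖propagatorK C Finset.univ A msq a K g x‖
              ≤ c₀ * P.mesh K ^ 2 * Real.exp (-(δA K₀ * (D / (P.L : ℝ) ^ K))) * M := by
  obtain ⟨Cγ, Cβ, hCγ, hCβ, ce, hce, hcube⟩ := cube_inputs_regular d L hL ha hmsq N C ε₀
  have hlog2 : 0 < Real.log 2 := Real.log_pos (by norm_num)
  refine ⟨4 * 2 ^ d * Cγ, by positivity, max 8 (⌈(2 : ℝ) ^ (d + 2) * Cβ⌉₊), ce, fun K₀ => Real.log 2 * 4 / (5 * K₀ + 8),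
    fun K₀ => ⟨hce K₀, div_pos (mul_pos hlog2 (by norm_num)) (by positivity)⟩, fun K₀ hK₀ => ?_⟩
  have hK₀8 : 8 ≤ K₀ := le_trans (le_max_left _ _) hK₀
  have hK₀C : (2 : ℝ) ^ (d + 2) * Cβ ≤ K₀ :=
    (Nat.le_ceil _).trans (by exact_mod_cast le_trans (le_max_right _ _) hK₀)
  have h22 : (2 : ℝ) ^ (d + 2) = 2 ^ d * 4 := by rw [pow_add]; norm_num
  rw [h22] at hK₀C
  intro P S hPd hPL hK₀M K hK1 hK hN3 hε A δ hreg hsmallA g M D hg hD0 x hD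
  have hcj := fun j => hcube K₀ hK₀8 P S hPd hPL hK₀M hK1 hK hN3 hε A hreg hsmallA j
  subst hPd
  have hL1 : (1 : ℝ) < P.L := by rw [hPL]; exact_mod_cast hL.2
  have hmesh : 0 < P.mesh K := P.mesh_pos K
  have hakP : 0 ≤ B1.aSeq a P.L K := (B1.aSeq_pos ha hL1 hK1).le
  have hM0 : 0 ≤ M := (norm_nonneg _).trans (hg x)
  have hK₀pos : (0 : ℝ) < K₀ := by exact_mod_cast (show 0 < K₀ by omega)
  -- the rate `δ' = log 2/(2rS)`: `e^{δ'·2rS} = 2`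
  have hrS : (0 : ℝ) < rS P K K₀ := by
    have : 1 ≤ rS P K K₀ := by unfold rS; have := Nat.one_le_pow K P.L P.hL; omega
    exact_mod_cast this
  set δ' : ℝ := Real.log 2 / (2 * rS P K K₀) with hδ_def
  have hδ0 : 0 ≤ δ' := by positivity
  have hexp : Real.exp (δ' * (2 * rS P K K₀)) = 2 := by
    rw [hδ_def, div_mul_cancel₀ _ (by positivity), Real.exp_log two_pos]
  have hsmall : (2 : ℝ) ^ P.d * (Cβ / K₀) * Real.exp (δ' * (2 * rS P K K₀)) ≤ 1 / 2 := by
    rw [hexp]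
    have e : (2 : ℝ) ^ P.d * (Cβ / K₀) * 2 = (2 ^ P.d * 2 * Cβ) / K₀ := by ring
    rw [e, div_le_iff₀ hK₀pos]
    linarith
  have hmain := norm_propagatorK_univ_decay_le C hK hK₀M hK₀8 hmsq a hakP A (γ := Cγ * P.mesh K ^ 2)
    (β := Cβ / K₀) (by positivity) (by positivity) (fun j ψ => (hcj j).1 ψ) (fun j ψ => (hcj j).2 ψ) hδ0 hsmall g hg hD0 x hD
  rw [hexp] at hmain
  have h8 : 8 * (rS P K K₀ : ℝ) ≤ (5 * (K₀ : ℝ) + 8) * (P.L : ℝ) ^ K := by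
    have h := eight_rS_le (P := P) (K := K) (K₀ := K₀)
    have h' : ((8 * rS P K K₀ : ℕ) : ℝ) ≤ ((5 * half P K K₀ + 8 * P.L ^ K : ℕ) : ℝ) := by exact_mod_cast h
    unfold half at h'
    push_cast at h'
    linarith
  have hcmp : Real.log 2 * 4 / (5 * (K₀ : ℝ) + 8) * (D / (P.L : ℝ) ^ K) ≤ δ' * D := by
    rw [hδ_def, div_mul_div_comm, div_mul_eq_mul_div, div_le_div_iff₀ (by positivity) (by positivity)]
    have hlogD : 0 ≤ Real.log 2 * D := mul_nonneg hlog2.le hD0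
    calc Real.log 2 * 4 * D * (2 * (rS P K K₀ : ℝ)) = Real.log 2 * D * (8 * (rS P K K₀ : ℝ)) := by ring
      _ ≤ Real.log 2 * D * ((5 * (K₀ : ℝ) + 8) * (P.L : ℝ) ^ K) := mul_le_mul_of_nonneg_left h8 hlogD
  have hexpD : Real.exp (-(δ' * D)) ≤ Real.exp (-(Real.log 2 * 4 / (5 * (K₀ : ℝ) + 8) * (D / (P.L : ℝ) ^ K))) :=
    Real.exp_le_exp.2 (by linarith)
  calc ‖propagatorK C Finset.univ A msq a K g x‖
      ≤ 2 * 2 ^ P.d * (Cγ * P.mesh K ^ 2 * 2) * Real.exp (-(δ' * D)) * M := hmain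
    _ ≤ 2 * 2 ^ P.d * (Cγ * P.mesh K ^ 2 * 2) * Real.exp (-(Real.log 2 * 4 / (5 * (K₀ : ℝ) + 8) * (D / (P.L : ℝ) ^ K))) * M :=
        mul_le_mul_of_nonneg_right (mul_le_mul_of_nonneg_left hexpD (by positivity)) hM0
    _ = 4 * 2 ^ P.d * Cγ * P.mesh K ^ 2 * Real.exp (-(Real.log 2 * 4 / (5 * (K₀ : ℝ) + 8) * (D / (P.L : ℝ) ^ K))) * M := by
        ring

/-- **THE SAME, WITH THE CUBE CONDITION AS «`K₀ ∣ M`, `3K₀ ≦ 2M`»** (then `3·L^KK₀ ≦ |T_ε|_μ` at every level `K ≦ K_P`).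
[cite: Balaban1982Higgs1, Prop. 2.1 (2.25) p.610] [cite: Balaban1983RegularityDecay, Theorem (1.10) p.573] -/
theorem norm_propagatorK_regular_decay (d L : ℕ) (hL : Odd L ∧ 1 < L) {a : ℝ} (ha : 0 < a) {msq : ℝ} (hmsq : 0 < msq)
    (N : ℕ) (C : ChargeData N) (ε₀ : ℝ) :
    ∃ c₀ : ℝ, 0 < c₀ ∧ ∃ K₀min : ℕ, ∃ ce δA : ℕ → ℝ, (∀ K₀, 0 < ce K₀ ∧ 0 < δA K₀) ∧ ∀ K₀ : ℕ, K₀min ≤ K₀ →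
      ∀ (P : HiggsLattice.Params) (_S : Shape P), P.d = d → P.L = L → K₀ ∣ P.M → 3 * K₀ ≤ 2 * P.M →
      ∀ {K : ℕ}, 1 ≤ K → K ≤ P.K → P.mesh K ≤ ε₀ →
      ∀ (A : HiggsLattice.VecField P 0) {δ : ℝ},
        (∀ (z : HiggsLattice.Site P 0) (μ ν : Fin P.d), |A ⟨z.shift ν, μ⟩ - A ⟨z, μ⟩| ≤ δ) →
        ((P.L : ℝ) ^ K) ^ 2 * P.mesh 0 * |C.e| * δ ≤ ce K₀ →
        ∀ (g : HiggsLattice.ScalarField P 0 N) (M D : ℝ), (∀ x, ‖g x‖ ≤ M) → 0 ≤ D →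
          ∀ x, (∀ z, g z ≠ 0 → D ≤ (HiggsLattice.Site.tdist x z : ℝ)) →
            ‖propagatorK C Finset.univ A msq a K g x‖
              ≤ c₀ * P.mesh K ^ 2 * Real.exp (-(δA K₀ * (D / (P.L : ℝ) ^ K))) * M := by
  obtain ⟨c₀, hc₀, K₀min, ce, δA, hcδ, h⟩ := norm_propagatorK_regular_decay_of_cubes d L hL ha hmsq N C ε₀
  exact ⟨c₀, hc₀, K₀min, ce, δA, hcδ, fun K₀ hK₀ P S hPd hPL hK₀M h3M K hK1 hK hε A δ hreg hsmallA g M D hg hD0 x hD =>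
    h K₀ hK₀ P S hPd hPL hK₀M hK1 hK (three_half_le_sites hK h3M) hε A hreg hsmallA g M D hg hD0 x hD⟩

end Main

/-! ## §3 (2.27) on `T_ε` at a general regular field -/

section Ineq227

open HiggsLattice (siteInner ScalarField)
open B1Eq230FluctCov (mat Ix deltaKA)
open B1Ineq227BackgroundTorus (ineq227_of_decay decay_mono_rate)

/-- **PROPOSITION 2.2 (2.27) ON `Ω = T_ε` AT A GENERAL REGULAR FIELD, EVERY LEVEL.**  For odd `L > 1`, `a, m² > 0`, `N`, `(e, q)`, `ε₀`
there are `c > 0`, `K₀min`, and per cube size `K₀` a threshold `c_e(K₀) > 0` and a rate `0 < δ₀(K₀) ≦ 1` such that for `K₀ ≧ K₀min`, on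
every torus of the sub-family with `K₀ ∣ M`, at every level `1 ≦ k ≦ K_P` with `3·L^kK₀ ≦ |T_ε|_μ` and `L^kε ≦ ε₀`, for every `δ`-regular
`A` on `T_ε` with `L^{2k}ε|e|δ ≦ c_e(K₀)` and ALL `p = (x, i)`, `q = (x′, i′)`:
`|Δ^{(k),L^kε}(T_ε, A)(p, q)| ≦ c·(L^kε)^{−2}·e^{−δ₀(K₀)|x − x′|}` — r14 g13's `ineq227_of_decay` (p316504) on §2.
[cite: Balaban1982Higgs1, Prop. 2.2 (2.27) p.611, (2.21) p.610] [cite: Balaban1983RegularityDecay, Cor. 2.3 p.580, p.594] -/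
theorem ineq227_regular_torus (d L : ℕ) (hL : Odd L ∧ 1 < L) {a : ℝ} (ha : 0 < a) {msq : ℝ} (hmsq : 0 < msq) (N : ℕ)
    (C : ChargeData N) (ε₀ : ℝ) :
    ∃ c : ℝ, 0 < c ∧ ∃ K₀min : ℕ, ∃ ce δ₀ : ℕ → ℝ, (∀ K₀, 0 < ce K₀ ∧ 0 < δ₀ K₀ ∧ δ₀ K₀ ≤ 1) ∧
      ∀ K₀ : ℕ, K₀min ≤ K₀ →
      ∀ (P : HiggsLattice.Params) (_S : Shape P), P.d = d → P.L = L → K₀ ∣ P.M →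
      ∀ {k : ℕ}, 1 ≤ k → k ≤ P.K → (∀ μ, 3 * half P k K₀ ≤ P.sitesPerDir 0 μ) → P.mesh k ≤ ε₀ →
      ∀ (A : HiggsLattice.VecField P 0) {δ : ℝ},
        (∀ (z : HiggsLattice.Site P 0) (μ ν : Fin P.d), |A ⟨z.shift ν, μ⟩ - A ⟨z, μ⟩| ≤ δ) →
        ((P.L : ℝ) ^ k) ^ 2 * P.mesh 0 * |C.e| * δ ≤ ce K₀ →
        ∀ p q : HiggsLattice.Site P k × Ix N,
          |mat (deltaKA C Finset.univ A msq a k) p q| ≤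
            c * (P.mesh k)⁻¹ ^ 2 * Real.exp (-(δ₀ K₀ * (HiggsLattice.Site.tdist p.1 q.1 : ℝ))) := by
  obtain ⟨c₀, hc₀, K₀min, ce, δA, hcδ, hdec⟩ := norm_propagatorK_regular_decay_of_cubes d L hL ha hmsq N C ε₀
  refine ⟨a + a ^ 2 * Real.sqrt N * c₀ * Real.exp 1, by positivity, K₀min, ce, fun K₀ => min (δA K₀) 1,
    fun K₀ => ⟨(hcδ K₀).1, lt_min (hcδ K₀).2 one_pos, min_le_right _ _⟩, ?_⟩
  intro K₀ hK₀ P S hPd hPL hK₀M k hk1 hk hN3 hε A δ hreg hsmallA p q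
  obtain ⟨j, rfl⟩ : ∃ j, k = j + 1 := ⟨k - 1, by omega⟩
  have hL1 : (1 : ℝ) < P.L := by rw [hPL]; exact_mod_cast hL.2
  have hd' : ∀ (g : ScalarField P 0 N) (M D : ℝ), (∀ x, ‖g x‖ ≤ M) → 0 ≤ D →
      ∀ x, (∀ z, g z ≠ 0 → D ≤ (HiggsLattice.Site.tdist x z : ℝ)) →
        ‖propagatorK C Finset.univ A msq a (j + 1) g x‖ ≤
          c₀ * P.mesh (j + 1) ^ 2 * Real.exp (-(min (δA K₀) 1 * (D / (P.L : ℝ) ^ (j + 1)))) * M :=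
    decay_mono_rate C A msq a (mul_nonneg hc₀.le (sq_nonneg _)) (min_le_left _ _)
      (fun g M D hg hD x hs => hdec K₀ hK₀ P S hPd hPL hK₀M hk1 hk hN3 hε A hreg hsmallA g M D hg hD x hs)
  exact ineq227_of_decay C A msq a hk ha hL1 hc₀.le (lt_min (hcδ K₀).2 one_pos).le (min_le_right _ _) hd' p q

end Ineq227

/-! ## §4 (2.33) LOWER HALF on `T_ε` at a general regular field, one smallness parameter -/

section Lower

open HiggsLattice (siteInner ScalarField)
open B1Eq230FluctCov (precOpA)
open B2Ineq329RegularField (gamma0_regular_spec)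
open B1Ineq233LowerBackgroundTorus (ineq233_lower_regular_torus)

/-- **(2.33) LOWER HALF ON `T_ε` AT A GENERAL REGULAR FIELD, ONE SMALLNESS PARAMETER** — r14 g13's `ineq233_lower_regular_torus`
(p317716) with its three smallness conditions discharged from `L^kδ·|e| ≦ t₀`: for `d`, `L`, `a, m² > 0` there are `t₀ > 0`, `γ > 0`
(functions of `d, L, a, m²`; `γ = min{a, 4γ₀}/(2L²)`) such that on every torus of the family, at every `1 ≦ k = j+1 < K_P` with `L^kε ≦ 1` and
`|T^{(k+1)}|_μ ≧ 2`, for every `δ`-regular `A` with `L^kδ·|e| ≦ t₀` (for the printed (2.23) `L^kδ = ce(L^kε)^β`: `ce² ≦ t₀`, «e sufficiently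
small») and EVERY `ψ`: `γ(L^kε)^{−2}‖ψ‖² ≦ ⟨ψ, (a(L^{k+1}ε)^{−2}P(A) + Δ^{(k),L^kε}(T_ε, A))ψ⟩`.
[cite: Balaban1982Higgs1, Prop. 2.3 (2.33) p.611, (2.23) p.610] [cite: Balaban1983RegularityDecay, §5 (5.2)–(5.3) p.593] -/
theorem ineq233_lower_regular_torus_small (d L : ℕ) (hL1 : 1 < L) {a msq : ℝ} (ha : 0 < a) (hmsq : 0 < msq) (N : ℕ)
    (C : ChargeData N) :
    ∃ t₀ : ℝ, 0 < t₀ ∧ ∃ γ : ℝ, 0 < γ ∧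
      ∀ (P : HiggsLattice.Params), P.d = d → P.L = L →
      ∀ {j : ℕ}, j + 1 < P.K → (∀ μ, 2 ≤ P.sitesPerDir (j + 1 + 1) μ) → P.mesh (j + 1) ≤ 1 →
      ∀ (A : HiggsLattice.VecField P 0) {δ : ℝ}, 0 ≤ δ →
        (∀ (z : HiggsLattice.Site P 0) (μ' ν : Fin P.d), |A ⟨z.shift ν, μ'⟩ - A ⟨z, μ'⟩| ≤ δ) →
        (P.L : ℝ) ^ (j + 1) * δ * |C.e| ≤ t₀ →
        ∀ ψ : ScalarField P (j + 1) N,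
          γ * ((P.mesh (j + 1))⁻¹ ^ 2) * siteInner ψ ψ ≤ siteInner ψ (precOpA C Finset.univ A msq a (j + 1) ψ) := by
  obtain ⟨γ₀, hγ₀⟩ : ∃ γ₀ : ℝ, γ₀ = min (a * (1 - ((L : ℝ) ^ 2)⁻¹) / (8 * (d : ℝ) + 2 * msq + 4)) (1 / 16) := ⟨_, rfl⟩
  obtain ⟨c₁, hc₁⟩ : ∃ c₁ : ℝ, c₁ = min a (4 * γ₀) / (L : ℝ) ^ 2 := ⟨_, rfl⟩
  obtain ⟨T, hT⟩ : ∃ T : ℝ, T = min 1 (min (1 / (16 * ((d : ℝ) ^ 4 * (L : ℝ) ^ d) + 1))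
      (min (c₁ / (256 * (γ₀ * (d : ℝ) ^ 3) + 1)) (1 / (4 * ((d : ℝ) ^ 3 * (L : ℝ) ^ 4) + 1)))) := ⟨_, rfl⟩
  have hLr : (1 : ℝ) < (L : ℝ) := by exact_mod_cast hL1
  have hγ₀pos : 0 < γ₀ := by
    rw [hγ₀]
    refine lt_min (div_pos (mul_pos ha ?_) (by positivity)) (by norm_num)
    have h1 : (1 : ℝ) < (L : ℝ) ^ 2 := by
      have h := mul_lt_mul hLr hLr.le zero_lt_one (zero_le_one.trans hLr.le)
      rw [one_mul] at h; rw [sq]; exact h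
    have : ((L : ℝ) ^ 2)⁻¹ < 1 := inv_lt_one_of_one_lt₀ h1
    linarith
  have hc₁pos : 0 < c₁ := by rw [hc₁]; exact div_pos (lt_min ha (by linarith)) (by positivity)
  have hX0 : 0 ≤ (d : ℝ) ^ 4 * (L : ℝ) ^ d := by positivity
  have hY0 : 0 ≤ γ₀ * (d : ℝ) ^ 3 := by positivity
  have hZ0 : 0 ≤ (d : ℝ) ^ 3 * (L : ℝ) ^ 4 := by positivity
  have hTpos : 0 < T := by
    rw [hT]
    exact lt_min one_pos (lt_min (by positivity) (lt_min (div_pos hc₁pos (by positivity)) (by positivity)))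
  refine ⟨T, hTpos, c₁ / 2, by linarith, ?_⟩
  intro P hPd hPL j hjK hN2 hs A δ hδ hreg ht ψ
  subst hPd hPL
  have hLnat : 1 < P.L := hL1
  have hmesh : 0 < P.mesh (j + 1) := P.mesh_pos _
  have hmeshK : P.mesh (j + 1) = (P.L : ℝ) ^ (j + 1) * P.mesh 0 := by
    unfold HiggsLattice.Params.mesh; ring
  have hT1 : T ≤ 1 := by rw [hT]; exact min_le_left _ _
  have hu0 : 0 ≤ (P.L : ℝ) ^ (j + 1) * δ * |C.e| := by positivity
  -- the basic square: `(Lᵏδ)²e²s² ≤ T`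
  have hsq : ((P.L : ℝ) ^ (j + 1) * δ) ^ 2 * C.e ^ 2 * P.mesh (j + 1) ^ 2 ≤ T := by
    have h1 : ((P.L : ℝ) ^ (j + 1) * δ * |C.e|) ^ 2 ≤ T ^ 2 := pow_le_pow_left₀ hu0 ht 2
    have h2 : T ^ 2 ≤ T := by nlinarith
    have hs2 : P.mesh (j + 1) ^ 2 ≤ 1 := pow_le_one₀ hmesh.le hs
    calc ((P.L : ℝ) ^ (j + 1) * δ) ^ 2 * C.e ^ 2 * P.mesh (j + 1) ^ 2
        = ((P.L : ℝ) ^ (j + 1) * δ * |C.e|) ^ 2 * P.mesh (j + 1) ^ 2 := by rw [mul_pow _ |C.e|, sq_abs]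
      _ ≤ T ^ 2 * 1 := mul_le_mul h1 hs2 (sq_nonneg _) (sq_nonneg _)
      _ ≤ T := by rw [mul_one]; exact h2
  -- the constant `γ₀` of (II.3.29) at a regular field
  obtain ⟨-, hγB, hγ16⟩ := gamma0_regular_spec (P := P) ha hLnat hmsq.le
  rw [← hγ₀] at hγB hγ16
  -- (i) `hsmall`
  have hsmall : 8 * (P.d : ℝ) ^ 4 * (P.L : ℝ) ^ P.d * C.e ^ 2 * P.mesh (j + 1) ^ 2 *
      ((P.L : ℝ) ^ (j + 1)) ^ 2 * δ ^ 2 ≤ 1 / 2 := by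
    have hTX : T ≤ 1 / (16 * ((P.d : ℝ) ^ 4 * (P.L : ℝ) ^ P.d) + 1) := by
      rw [hT]; exact (min_le_right _ _).trans (min_le_left _ _)
    rw [le_div_iff₀ (by positivity)] at hTX
    calc 8 * (P.d : ℝ) ^ 4 * (P.L : ℝ) ^ P.d * C.e ^ 2 * P.mesh (j + 1) ^ 2 * ((P.L : ℝ) ^ (j + 1)) ^ 2 * δ ^ 2
        = 8 * ((P.d : ℝ) ^ 4 * (P.L : ℝ) ^ P.d) * (((P.L : ℝ) ^ (j + 1) * δ) ^ 2 * C.e ^ 2 * P.mesh (j + 1) ^ 2) := by ring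
      _ ≤ 8 * ((P.d : ℝ) ^ 4 * (P.L : ℝ) ^ P.d) * T := mul_le_mul_of_nonneg_left hsq (by positivity)
      _ ≤ 1 / 2 := by linarith [mul_nonneg hX0 hTpos.le]
  -- (ii) `hE`
  have hEE : 64 * γ₀ * (P.d : ℝ) ^ 3 * C.e ^ 2 * ((P.L : ℝ) ^ (j + 1)) ^ 2 * δ ^ 2 * P.mesh (j + 1) ^ 2
      ≤ min a (4 * γ₀) / (P.L : ℝ) ^ 2 / 4 := by
    have hTY : T ≤ c₁ / (256 * (γ₀ * (P.d : ℝ) ^ 3) + 1) := by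
      rw [hT]; exact (min_le_right _ _).trans ((min_le_right _ _).trans (min_le_left _ _))
    rw [le_div_iff₀ (by positivity)] at hTY
    rw [← hc₁]
    calc 64 * γ₀ * (P.d : ℝ) ^ 3 * C.e ^ 2 * ((P.L : ℝ) ^ (j + 1)) ^ 2 * δ ^ 2 * P.mesh (j + 1) ^ 2
        = 64 * (γ₀ * (P.d : ℝ) ^ 3) * (((P.L : ℝ) ^ (j + 1) * δ) ^ 2 * C.e ^ 2 * P.mesh (j + 1) ^ 2) := by ring
      _ ≤ 64 * (γ₀ * (P.d : ℝ) ^ 3) * T := mul_le_mul_of_nonneg_left hsq (by positivity)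
      _ ≤ c₁ / 4 := by linarith [mul_nonneg hY0 hTpos.le]
  -- (iii) `hθ`
  have hθ : (P.L : ℝ) ^ 2 * P.d *
      (2 * P.d * P.L * ((P.L : ℝ) ^ (j + 1)) ^ 2 * (P.mesh 0 * |C.e|) * δ) ^ 2 ≤ 1 := by
    have hTZ : T ≤ 1 / (4 * ((P.d : ℝ) ^ 3 * (P.L : ℝ) ^ 4) + 1) := by
      rw [hT]; exact (min_le_right _ _).trans ((min_le_right _ _).trans (min_le_right _ _))
    rw [le_div_iff₀ (by positivity)] at hTZ
    have e1 : ((P.L : ℝ) ^ (j + 1)) ^ 2 * P.mesh 0 * δ = ((P.L : ℝ) ^ (j + 1) * δ) * P.mesh (j + 1) := by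
      rw [hmeshK]; ring
    calc (P.L : ℝ) ^ 2 * P.d * (2 * P.d * P.L * ((P.L : ℝ) ^ (j + 1)) ^ 2 * (P.mesh 0 * |C.e|) * δ) ^ 2
        = 4 * ((P.d : ℝ) ^ 3 * (P.L : ℝ) ^ 4) * ((((P.L : ℝ) ^ (j + 1)) ^ 2 * P.mesh 0 * δ) ^ 2 * |C.e| ^ 2) := by ring
      _ = 4 * ((P.d : ℝ) ^ 3 * (P.L : ℝ) ^ 4) * (((P.L : ℝ) ^ (j + 1) * δ) ^ 2 * C.e ^ 2 * P.mesh (j + 1) ^ 2) := by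
          rw [e1, sq_abs]; ring
      _ ≤ 4 * ((P.d : ℝ) ^ 3 * (P.L : ℝ) ^ 4) * T := mul_le_mul_of_nonneg_left hsq (by positivity)
      _ ≤ 1 := by linarith [mul_nonneg hZ0 hTpos.le]
  have hmain := ineq233_lower_regular_torus C ha hLnat hmsq hjK hN2 hs A hδ hreg hsmall hγ₀pos.le hγB hγ16 hEE hθ ψ
  rw [← hc₁] at hmain
  exact hmain

end Lower

/-! ## §5 (2.34)/(2.36) on `T_ε` at a general regular field, scale-uniform constants -/

section Covariances

open HiggsLattice (siteInner ScalarField)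
open HiggsCondCov232 (condCov232 deltaCov235)
open B1Eq230FluctCov (mat Ix deltaKA precOpA)
open B1Ineq233LowerZeroField (mesh_succ)
open B1Ineq234Concrete (profile profile_nonneg' nCol distC distC_nonneg ineq234_concrete_of_deltaKA ineq236_concrete_of_deltaKA)
open B4Sect5Torus (cSt dSt cSt_pos dSt_pos profile_nonneg)
open B1Ineq234ZeroFieldRegionUniform (decay_transfer profile_anti)
open B1Ineq234BackgroundTorus (two_le_sitesPerDir mesh_inv_sq_facts)

/-- **PROPOSITION 2.3 (2.34) AND (2.36) ON `Ω = T_ε` AT A GENERAL REGULAR FIELD, EVERY LEVEL `1 ≦ k < K_P`, EVERY `Λ ⊂ T^{(k)}`,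
SCALE-UNIFORM CONSTANTS** — *"independent of A, k, Ω and Λ"* as printed (here `Ω = T_ε`).  For odd `L > 1`, `a, m² > 0`, `N`, `(e, q)`:
there are `K₀min` and `t_A, c₁, δ₁ : ℕ → ℝ_{>0}` such that for every cube size `K₀ ≧ K₀min`, on every torus of the sub-family with
`K₀ ∣ M`, at every level `1 ≦ k < K_P` with `3·L^kK₀ ≦ |T_ε|_μ` and `L^kε ≦ 1`, for every `δ`-regular `A` on `T_ε` with `L^kδ·|e| ≦ t_A(K₀)`
(for the printed (2.23), `L^kδ = ce(L^kε)^β`: «e sufficiently small»), every `Λ` and all `p = (x, i)`, `q = (x′, i′)` with `x, x′ ∈ Λ`: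
`|C^{(k),L^kε}_Λ(T_ε, A)(p, q)| ≦ (L^kε)²·c₁(K₀)·e^{−δ₁(K₀)|x − x′|}` and
`|δC^{(k),L^kε}_Λ(T_ε, A)(p, q)| ≦ (L^kε)²·c₁(K₀)·e^{−δ₁(K₀)(|x − x′| + dist(x,Λᶜ) + dist(x′,Λᶜ))}` — r14 g7's Sect.-5 engine fed with §3 and
§4, constants transferred by r14 g9's `decay_transfer`, verbatim the assembly of `B1Ineq234BackgroundTorus.ineq234_236_bgVec_torus` (p318167).
[cite: Balaban1982Higgs1, Prop. 2.3 (2.34) p.611, (2.36) p.612] [cite: Balaban1983RegularityDecay, Sect. 5 (5.4)–(5.6) p.594] -/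
theorem ineq234_236_regular_torus (d L : ℕ) (hL : Odd L ∧ 1 < L) {a : ℝ} (ha : 0 < a) {msq : ℝ} (hmsq : 0 < msq) (N : ℕ)
    (C : ChargeData N) :
    ∃ K₀min : ℕ, ∃ tA c₁ δ₁ : ℕ → ℝ, (∀ K₀, 0 < tA K₀ ∧ 0 < c₁ K₀ ∧ 0 < δ₁ K₀) ∧
      ∀ K₀ : ℕ, K₀min ≤ K₀ →
      ∀ (P : HiggsLattice.Params) (_S : Shape P), P.d = d → P.L = L → K₀ ∣ P.M →
      ∀ {k : ℕ}, 1 ≤ k → k < P.K → (∀ μ, 3 * half P k K₀ ≤ P.sitesPerDir 0 μ) → P.mesh k ≤ 1 →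
      ∀ (A : HiggsLattice.VecField P 0) {δ : ℝ}, 0 ≤ δ →
        (∀ (z : HiggsLattice.Site P 0) (μ ν : Fin P.d), |A ⟨z.shift ν, μ⟩ - A ⟨z, μ⟩| ≤ δ) →
        (P.L : ℝ) ^ k * δ * |C.e| ≤ tA K₀ →
        ∀ (Λ : Finset (HiggsLattice.Site P k)) {p q : HiggsLattice.Site P k × Ix N}, p.1 ∈ Λ → q.1 ∈ Λ →
          |mat (condCov232 C Finset.univ A msq a k Λ) p q| ≤
              P.mesh k ^ 2 * c₁ K₀ * Real.exp (-(δ₁ K₀ * (HiggsLattice.Site.tdist p.1 q.1 : ℝ)))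
          ∧ |mat (deltaCov235 C Finset.univ A msq a k Λ) p q| ≤
              P.mesh k ^ 2 * c₁ K₀ * Real.exp (-(δ₁ K₀ *
                ((HiggsLattice.Site.tdist p.1 q.1 : ℝ) + distC Λ p.1 + distC Λ q.1))) := by
  obtain ⟨c, hc, K₀min, ce, δ₀, hcδ, hΔ⟩ := ineq227_regular_torus d L hL ha hmsq N C 1
  obtain ⟨t₀, ht₀, γ, hγ, hlow⟩ := ineq233_lower_regular_torus_small d L hL.2 ha hmsq N C
  obtain ⟨cU, hcU⟩ : ∃ cU : ℕ → ℝ, cU = fun K₀ => a * ((L : ℝ) ^ 2)⁻¹ * Real.exp (δ₀ K₀ * ((L : ℝ) - 1)) + c :=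
    ⟨_, rfl⟩
  have hcU0 : ∀ K₀, 0 ≤ cU K₀ := fun K₀ => by rw [hcU]; positivity
  refine ⟨K₀min, fun K₀ => min (ce K₀) t₀,
    fun K₀ => cSt (fun t => (nCol N : ℝ) * B4Sect5Proof.latticeConst d t) γ (cU K₀) (δ₀ K₀),
    fun K₀ => dSt (fun t => (nCol N : ℝ) * B4Sect5Proof.latticeConst d t) γ (cU K₀) (δ₀ K₀),
    fun K₀ => ⟨lt_min (hcδ K₀).1 ht₀, cSt_pos _ _ _ hγ,
      dSt_pos (profile_nonneg d (nCol N)) hγ (hcU0 K₀) (hcδ K₀).2.1⟩, ?_⟩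
  intro K₀ hK₀ P S hPd hPL hK₀M k hk1 hk hN3 hs A δ hδ hreg ht Λ p q hp hq
  obtain ⟨j, rfl⟩ : ∃ j, k = j + 1 := ⟨k - 1, by omega⟩
  -- the two smallness inputs from `L^kδ|e| ≤ min(c_e, t₀)` and `L^kε ≤ 1`
  have hmeshK : P.mesh (j + 1) = (P.L : ℝ) ^ (j + 1) * P.mesh 0 := by
    unfold HiggsLattice.Params.mesh; ring
  have hsmallA : ((P.L : ℝ) ^ (j + 1)) ^ 2 * P.mesh 0 * |C.e| * δ ≤ ce K₀ := by
    have hu0 : 0 ≤ (P.L : ℝ) ^ (j + 1) * δ * |C.e| := by positivity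
    calc ((P.L : ℝ) ^ (j + 1)) ^ 2 * P.mesh 0 * |C.e| * δ = ((P.L : ℝ) ^ (j + 1) * δ * |C.e|) * P.mesh (j + 1) := by
          rw [hmeshK]; ring
      _ ≤ ((P.L : ℝ) ^ (j + 1) * δ * |C.e|) * 1 := mul_le_mul_of_nonneg_left hs hu0
      _ ≤ ce K₀ := by rw [mul_one]; exact ht.trans (min_le_left _ _)
  have hΔ' := hΔ K₀ hK₀ P S hPd hPL hK₀M hk1 hk.le hN3 hs A hreg hsmallA
  have hlow' := hlow P hPd hPL hk (fun μ => two_le_sitesPerDir P (j + 1 + 1) μ) hs A hδ hreg (ht.trans (min_le_right _ _))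
  subst hPd hPL
  rcases mesh_inv_sq_facts P (j + 1) with ⟨hsinv, hsucc, hs1⟩ | hns
  swap
  · exact absurd hs hns
  have hs0 : 0 < (P.mesh (j + 1))⁻¹ ^ 2 := by positivity
  have hδ0 := (hcδ K₀).2.1
  have e : a * ((P.mesh (j + 1 + 1))⁻¹ ^ 2) * Real.exp (δ₀ K₀ * ((P.L : ℝ) - 1)) + c * (P.mesh (j + 1))⁻¹ ^ 2
      = cU K₀ * (P.mesh (j + 1))⁻¹ ^ 2 := by
    rw [hsucc, hcU]; ring
  have htd : 0 ≤ (HiggsLattice.Site.tdist p.1 q.1 : ℝ) := Nat.cast_nonneg _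
  have htd' : 0 ≤ (HiggsLattice.Site.tdist p.1 q.1 : ℝ) + distC Λ p.1 + distC Λ q.1 :=
    add_nonneg (add_nonneg htd (distC_nonneg Λ _)) (distC_nonneg Λ _)
  have hlow'' : ∀ f : ScalarField P (j + 1) N, γ * (P.mesh (j + 1))⁻¹ ^ 2 * siteInner f f
      ≤ siteInner f (precOpA C Finset.univ A msq a (j + 1) f) := hlow'
  have hΔ'' : ∀ p q : HiggsLattice.Site P (j + 1) × Ix N,
      |mat (deltaKA C Finset.univ A msq a (j + 1)) p q|
        ≤ c * (P.mesh (j + 1))⁻¹ ^ 2 * Real.exp (-(δ₀ K₀ * (HiggsLattice.Site.tdist p.1 q.1 : ℝ))) := hΔ'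
  constructor
  · have main := ineq234_concrete_of_deltaKA C Finset.univ A msq a hk ha.le
      (mul_pos hγ hs0) (mul_pos hc hs0) hδ0 hlow'' hΔ'' Λ hp hq
    rw [e] at main
    have htr := decay_transfer (K := profile P N) profile_nonneg' profile_anti hγ (hcU0 K₀) le_rfl hδ0 hs1 htd
    rw [hsinv] at htr
    exact main.trans (htr.trans_eq (by ring))
  · have main := ineq236_concrete_of_deltaKA C Finset.univ A msq a hk ha.le
      (mul_pos hγ hs0) (mul_pos hc hs0) hδ0 hlow'' hΔ'' Λ hp hq
    rw [e] at main
    have htr := decay_transfer (K := profile P N) profile_nonneg' profile_anti hγ (hcU0 K₀) le_rfl hδ0 hs1 htd'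
    rw [hsinv] at htr
    exact main.trans (htr.trans_eq (by ring))

/-- **(2.34)/(2.36) AT A GENERAL REGULAR FIELD, CUBE CONDITION «`K₀ ∣ M`, `3K₀ ≦ 2M`»**.
[cite: Balaban1982Higgs1, Prop. 2.3 (2.34) p.611, (2.36) p.612] -/
theorem ineq234_236_regular_torus_std (d L : ℕ) (hL : Odd L ∧ 1 < L) {a : ℝ} (ha : 0 < a) {msq : ℝ} (hmsq : 0 < msq)
    (N : ℕ) (C : ChargeData N) :
    ∃ K₀min : ℕ, ∃ tA c₁ δ₁ : ℕ → ℝ, (∀ K₀, 0 < tA K₀ ∧ 0 < c₁ K₀ ∧ 0 < δ₁ K₀) ∧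
      ∀ K₀ : ℕ, K₀min ≤ K₀ →
      ∀ (P : HiggsLattice.Params) (_S : Shape P), P.d = d → P.L = L → K₀ ∣ P.M → 3 * K₀ ≤ 2 * P.M →
      ∀ {k : ℕ}, 1 ≤ k → k < P.K → P.mesh k ≤ 1 →
      ∀ (A : HiggsLattice.VecField P 0) {δ : ℝ}, 0 ≤ δ →
        (∀ (z : HiggsLattice.Site P 0) (μ ν : Fin P.d), |A ⟨z.shift ν, μ⟩ - A ⟨z, μ⟩| ≤ δ) →
        (P.L : ℝ) ^ k * δ * |C.e| ≤ tA K₀ →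
        ∀ (Λ : Finset (HiggsLattice.Site P k)) {p q : HiggsLattice.Site P k × Ix N}, p.1 ∈ Λ → q.1 ∈ Λ →
          |mat (condCov232 C Finset.univ A msq a k Λ) p q| ≤
              P.mesh k ^ 2 * c₁ K₀ * Real.exp (-(δ₁ K₀ * (HiggsLattice.Site.tdist p.1 q.1 : ℝ)))
          ∧ |mat (deltaCov235 C Finset.univ A msq a k Λ) p q| ≤
              P.mesh k ^ 2 * c₁ K₀ * Real.exp (-(δ₁ K₀ *
                ((HiggsLattice.Site.tdist p.1 q.1 : ℝ) + distC Λ p.1 + distC Λ q.1))) := by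
  obtain ⟨K₀min, tA, c₁, δ₁, hpos, h⟩ := ineq234_236_regular_torus d L hL ha hmsq N C
  exact ⟨K₀min, tA, c₁, δ₁, hpos, fun K₀ hK₀ P S hPd hPL hK₀M h3M k hk1 hk hs A δ hδ hreg ht Λ p q hp hq =>
    h K₀ hK₀ P S hPd hPL hK₀M hk1 hk (three_half_le_sites hk.le h3M) hs A hδ hreg ht Λ hp hq⟩

end Covariances

end Literature.MathematicalPhysics.QuantumFieldTheory.Balaban1983to89.B1Props21to23RegularTorus

end
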